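import Summits.Ventures.HSemireg.WedgeHankelOuterExpansion

/-!
# Venture HSemireg — THE OUTER MONOMIALS ARE INDEPENDENT OVER THE SUB-ALGEBRA OF THE FIRST `M` PAIRS: a form on the first `M` pairs kills th-7's class `w_m(q)` IFF it
# kills every shifted sub-box class `w_M(σ^j q)`, `j ≤ m − M`; hence `Kr(Dm M, w_N q, k) = Hom(Dm M, k) ⊓ ⨅_{j ≤ N−M} Kr(Dm M, w_M(σ^j q), k)`

HONEST FRAMING. Part of the Lean index of the computation cell `pub-hsemireg` (seat p10 gen 22, Sunday typer «UNIFORM-IN-n»).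
Finite-dimensional EXTERIOR ALGEBRA over a field ONLY: no variety, no cohomology theory, no sheaf, no Ext group, no semiregularity map;
nothing here says that HC / HC_CM / HC_AV holds; no Literature fact is declared or used.  Custodian versions as in `WedgeHankelSiegelIdeal` (1/3); the dictionary (`w_N(q)` = the
class of the box on `N` pairs; `Dm M` = the generators of the first `M` pairs; `Kr(Dm M, ·, k)` = the kernel of the class on `k`-forms of the sub-box) is QUOTED, never asserted.

WHAT IS IN THE TREE.  The monomial model (`WedgeModel`/`WedgeModelCoord`: `Alg D`, `Hom D d`, `mul_mem_Alg`, the sign-free independence `triple_eq_zero` of `p x + q y + r xy`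
over `Alg D` for fresh generators `x ≠ y`), th-7's recursion (`WedgeHankelModel`: `w`, `Dm`, `xI_notMem`, `yI_notMem`, `w_mem_Hom`), and K37 (this seat, `WedgeHankelOuterExpansion`):
the outer expansion `w_eq_sum_powerset_Ico` and the easy inclusion `mul_w_eq_zero_of_forall_shift` / `iInf_Kr_w_shift_le_Kr_w`.  THIS FILE (namespace
`Summit.Ventures.HSemireg.Wedge.HankelOuter`, continued; imports K37):
* §354 supports: `Dm_subset_Dm`, `Alg_Dm_mono`, `X_mem_Alg_Dm` / `Y_mem_Alg_Dm`, `outer_prod_mem_Alg` (the outer monomial over `[M, m)` lies in `Alg(Dm m)`).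
* §355 **`outer_independent`: if `φ_S ∈ Alg(Dm M)` for every `S ⊆ [M, m)` and `Σ_S φ_S · Π_{a ∈ [M,m)} (y_a if a ∈ S else x_a) = 0` then every `φ_S = 0`** (`M ≤ m ≤ N`; induction on
  `m`, peeling the last pair with `triple_eq_zero`) — the `2^{m−M}` outer monomials are independent over the sub-algebra of the first `M` pairs.
* §356 THE CONVERSE OF K37: **`mul_w_shift_eq_zero_of_mul_w_eq_zero`** (`θ ∈ Alg(Dm M)`, `θ ∧ w_m(q) = 0` ⇒ `θ ∧ w_M(σ^j q) = 0` for all `j ≤ m − M`), the criterion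
  **`mul_w_eq_zero_iff_forall_shift`**, its kernel form **`mem_Kr_w_iff_forall_shift`** and the submodule identity
  **`Kr_w_eq_iInf_Kr_w_shift`: `Kr K (Dm M) (w_N q) k = Hom(Dm M, k) ⊓ ⨅_{j : Fin (N−M+1)} Kr K (Dm M) (w_M(σ^j q)) k`** — «the kernel of the class of the box on the forms of a
  sub-box of `M` pairs is the intersection of the kernels of the `N − M + 1` shifted classes of the sub-box» (every field, every `q`, every degree `k`).
NOT typed here: the resulting dimension count (an intersection of `N − M + 1` Hankel kernels of the sub-box, th-7's law for each) and its transport to an arbitrary pair set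
`T` with `|T| = M` (K25); anything Ext-side.  New names only.
-/

open Module

namespace Summit.Ventures.HSemireg.Wedge.HankelOuter

open Summit.Ventures.HSemireg.Wedge Summit.Ventures.HSemireg.Wedge.Kunneth Summit.Ventures.HSemireg.Wedge.Hankel
  Summit.Ventures.HSemireg.Wedge.BasisFree Summit.Ventures.HSemireg.Wedge.HankelSiegel Summit.Ventures.HSemireg.Wedge.HankelSiegelIdeal
  Summit.Ventures.HSemireg.Wedge.KunnethKernel Summit.Ventures.HSemireg.Wedge.HankelFrameChange

variable (K : Type*) [Field K] {N : ℕ}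

/-! ## §354. Supports -/

/-- `Dm M ⊆ Dm m` for `M ≤ m`: the generators of the first `M` pairs are among those of the first `m`. -/
theorem Dm_subset_Dm {M m : ℕ} (h : M ≤ m) : Dm N M ⊆ Dm N m := by
  intro i hi
  simp only [Dm, Finset.mem_filter, Finset.mem_univ, true_and] at hi ⊢
  omega

/-- `Alg(Dm M) ≤ Alg(Dm m)` for `M ≤ m`. -/
theorem Alg_Dm_mono {M m : ℕ} (h : M ≤ m) : Alg K (In N) (Dm N M) ≤ Alg K (In N) (Dm N m) := by
  apply Submodule.span_mono
  rintro _ ⟨s, hs, rfl⟩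
  exact ⟨s, subset_trans hs (Dm_subset_Dm h), rfl⟩

/-- `x_a ∈ Alg(Dm m)` for `a < m ≤ N`. -/
theorem X_mem_Alg_Dm {a m : ℕ} (ha : a < m) (hm : m ≤ N) : X K N a ∈ Alg K (In N) (Dm N m) := by
  have haN : a < N := by omega
  have hX : X K N a = gx K (xI a haN) := by simp only [X, dif_pos haN]
  rw [hX]
  exact B_mem_Alg K (Finset.singleton_subset_iff.mpr (by simp only [Dm, xI, Finset.mem_filter, Finset.mem_univ, true_and]; omega))

/-- `y_a ∈ Alg(Dm m)` for `a < m ≤ N`. -/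
theorem Y_mem_Alg_Dm {a m : ℕ} (ha : a < m) (hm : m ≤ N) : Y K N a ∈ Alg K (In N) (Dm N m) := by
  have haN : a < N := by omega
  have hY : Y K N a = gx K (yI a haN) := by simp only [Y, dif_pos haN]
  rw [hY]
  exact B_mem_Alg K (Finset.singleton_subset_iff.mpr (by simp only [Dm, yI, Finset.mem_filter, Finset.mem_univ, true_and]; omega))

/-- the outer monomial `Π_{a ∈ [M, m)} (y_a if a ∈ S else x_a)` lies in `Alg(Dm m)` (`M ≤ m ≤ N`, any `S`). -/
theorem outer_prod_mem_Alg (M : ℕ) : ∀ m, M ≤ m → m ≤ N → ∀ S : Finset ℕ,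
    ((List.Ico M m).map fun a => if a ∈ S then Y K N a else X K N a).prod ∈ Alg K (In N) (Dm N m) := by
  intro m hMm
  induction m, hMm using Nat.le_induction with
  | base =>
    intro _ S
    rw [List.Ico.self_empty, List.map_nil, List.prod_nil, ← B_empty (K := K) (n := N)]
    exact B_mem_Alg K (Finset.empty_subset _)
  | succ m hMm ih =>
    intro hm S
    have hm' : m ≤ N := by omega
    by_cases hS : m ∈ S
    · rw [← Finset.insert_erase hS, outer_prod_succ_insert K hMm (S.erase m)]
      exact mul_mem_Alg K (Alg_Dm_mono K (Nat.le_succ m) (ih hm' _)) (Y_mem_Alg_Dm K (Nat.lt_succ_self m) hm)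
    · rw [outer_prod_succ_of_notMem K hMm hS]
      exact mul_mem_Alg K (Alg_Dm_mono K (Nat.le_succ m) (ih hm' _)) (X_mem_Alg_Dm K (Nat.lt_succ_self m) hm)

/-! ## §355. Independence of the outer monomials over the sub-algebra of the first `M` pairs -/

/-- **INDEPENDENCE OF THE OUTER MONOMIALS: if `φ_S ∈ Alg(Dm M)` for every `S ⊆ [M, m)` and `Σ_{S ⊆ [M,m)} φ_S · Π_{a ∈ [M,m)} (y_a if a ∈ S else x_a) = 0`, then every `φ_S = 0`**
(`M ≤ m ≤ N`).  Induction on `m`: the sum over `S ⊆ [M, m+1)` is `A · x_m + B · y_m` with `A = Σ_{S ⊆ [M,m)} φ_S Π_S`, `B = Σ_{S ⊆ [M,m)} φ_{S ∪ {m}} Π_S` in `Alg(Dm m)`, and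
`x_m, y_m` are fresh for `Dm m` (`triple_eq_zero`). -/
theorem outer_independent (M : ℕ) : ∀ m, M ≤ m → m ≤ N → ∀ φ : Finset ℕ → HT K (In N),
    (∀ S ∈ (Finset.Ico M m).powerset, φ S ∈ Alg K (In N) (Dm N M)) →
    ∑ S ∈ (Finset.Ico M m).powerset, φ S * ((List.Ico M m).map fun a => if a ∈ S then Y K N a else X K N a).prod = 0 →
    ∀ S ∈ (Finset.Ico M m).powerset, φ S = 0 := by
  classical
  intro m hMm
  induction m, hMm using Nat.le_induction with
  | base =>
    intro _ φ _ h0 S hS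
    rw [Finset.Ico_self, Finset.powerset_empty, Finset.mem_singleton] at hS
    rw [Finset.Ico_self, Finset.powerset_empty, Finset.sum_singleton, List.Ico.self_empty, List.map_nil, List.prod_nil, mul_one] at h0
    rw [hS]
    exact h0
  | succ m hMm ih =>
    intro hm φ hφ h0
    have hmN : m < N := by omega
    have hnot : m ∉ Finset.Ico M m := fun h => by rw [Finset.mem_Ico] at h; omega
    have hX : X K N m = gx K (xI m hmN) := by simp only [X, dif_pos hmN]
    have hY : Y K N m = gx K (yI m hmN) := by simp only [Y, dif_pos hmN]
    have hsub : ∀ S ∈ (Finset.Ico M m).powerset, S ∈ (Finset.Ico M (m + 1)).powerset := fun S hS =>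
      Finset.mem_powerset.mpr ((Finset.mem_powerset.mp hS).trans (Finset.Ico_subset_Ico_right (Nat.le_succ m)))
    have hins : ∀ S ∈ (Finset.Ico M m).powerset, insert m S ∈ (Finset.Ico M (m + 1)).powerset := fun S hS =>
      Finset.mem_powerset.mpr (Finset.insert_subset (Finset.mem_Ico.mpr ⟨hMm, Nat.lt_succ_self m⟩) (Finset.mem_powerset.mp (hsub S hS)))
    rw [Nat.Ico_succ_right_eq_insert_Ico hMm, Finset.sum_powerset_insert hnot] at h0
    have h1 : ∑ S ∈ (Finset.Ico M m).powerset, φ S * ((List.Ico M (m + 1)).map fun a => if a ∈ S then Y K N a else X K N a).prod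
        = (∑ S ∈ (Finset.Ico M m).powerset, φ S * ((List.Ico M m).map fun a => if a ∈ S then Y K N a else X K N a).prod) * X K N m := by
      rw [Finset.sum_mul]
      refine Finset.sum_congr rfl fun S hS => ?_
      have hSm : m ∉ S := fun h => hnot (Finset.mem_powerset.mp hS h)
      rw [outer_prod_succ_of_notMem K hMm hSm, mul_assoc]
    have h2 : ∑ S ∈ (Finset.Ico M m).powerset, φ (insert m S) * ((List.Ico M (m + 1)).map fun a => if a ∈ insert m S then Y K N a else X K N a).prod
        = (∑ S ∈ (Finset.Ico M m).powerset, φ (insert m S) * ((List.Ico M m).map fun a => if a ∈ S then Y K N a else X K N a).prod) * Y K N m := by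
      rw [Finset.sum_mul]
      refine Finset.sum_congr rfl fun S _ => ?_
      rw [outer_prod_succ_insert K hMm S, mul_assoc]
    rw [h1, h2, hX, hY] at h0
    have hA : ∑ S ∈ (Finset.Ico M m).powerset, φ S * ((List.Ico M m).map fun a => if a ∈ S then Y K N a else X K N a).prod ∈ Alg K (In N) (Dm N m) :=
      Submodule.sum_mem _ fun S hS => mul_mem_Alg K (Alg_Dm_mono K hMm (hφ S (hsub S hS))) (outer_prod_mem_Alg K M m hMm hmN.le S)
    have hB : ∑ S ∈ (Finset.Ico M m).powerset, φ (insert m S) * ((List.Ico M m).map fun a => if a ∈ S then Y K N a else X K N a).prod ∈ Alg K (In N) (Dm N m) :=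
      Submodule.sum_mem _ fun S hS => mul_mem_Alg K (Alg_Dm_mono K hMm (hφ (insert m S) (hins S hS))) (outer_prod_mem_Alg K M m hMm hmN.le S)
    have hAB := triple_eq_zero K (xI_notMem hmN) (yI_notMem hmN) (xI_ne_yI hmN) hA hB (Submodule.zero_mem _) (by rw [zero_mul, add_zero]; exact h0)
    have ihA := ih hmN.le φ (fun S hS => hφ S (hsub S hS)) hAB.1
    have ihB := ih hmN.le (fun S => φ (insert m S)) (fun S hS => hφ (insert m S) (hins S hS)) hAB.2.1
    intro S hS
    have hS' := Finset.mem_powerset.mp hS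
    by_cases hSm : m ∈ S
    · have hE : S.erase m ∈ (Finset.Ico M m).powerset := by
        refine Finset.mem_powerset.mpr fun a ha => ?_
        have ha' := hS' (Finset.mem_of_mem_erase ha)
        have hne := Finset.ne_of_mem_erase ha
        rw [Finset.mem_Ico] at ha' ⊢
        omega
      have := ihB (S.erase m) hE
      rwa [Finset.insert_erase hSm] at this
    · refine ihA S (Finset.mem_powerset.mpr fun a ha => ?_)
      have ha' := hS' ha
      have hne : a ≠ m := fun h => hSm (h ▸ ha)
      rw [Finset.mem_Ico] at ha' ⊢
      omega

/-! ## §356. The converse of K37: killing the class kills every shifted sub-box class -/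

/-- **CONVERSE: a form `θ ∈ Alg(Dm M)` on the first `M` pairs with `θ ∧ w K N m q = 0` has `θ ∧ w K N M (σ^j q) = 0` for every `j ≤ m − M`** (`M ≤ m ≤ N`; the outer expansion
and the independence of the outer monomials, read at `S = [M, M + j)`). -/
theorem mul_w_shift_eq_zero_of_mul_w_eq_zero {M m : ℕ} (hMm : M ≤ m) (hm : m ≤ N) (q : ℕ → K) {θ : HT K (In N)} (hθ : θ ∈ Alg K (In N) (Dm N M))
    (h : θ * w K N m q = 0) : ∀ j ≤ m - M, θ * w K N M ((shift K)^[j] q) = 0 := by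
  classical
  intro j hj
  have hw : ∀ S : Finset ℕ, θ * w K N M ((shift K)^[S.card] q) ∈ Alg K (In N) (Dm N M) := fun S =>
    mul_mem_Alg K hθ (Hom_le_Alg K _ _ (w_mem_Hom K (by omega) _))
  have h0 : ∑ S ∈ (Finset.Ico M m).powerset, (θ * w K N M ((shift K)^[S.card] q)) * ((List.Ico M m).map fun a => if a ∈ S then Y K N a else X K N a).prod = 0 := by
    rw [w_eq_sum_powerset_Ico K M m hMm q, Finset.mul_sum] at h
    simpa only [mul_assoc] using h
  have h1 := outer_independent K M m hMm hm (fun S => θ * w K N M ((shift K)^[S.card] q)) (fun S _ => hw S) h0 (Finset.Ico M (M + j))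
    (Finset.mem_powerset.mpr (Finset.Ico_subset_Ico_right (by omega)))
  simpa only [Nat.card_Ico, Nat.add_sub_cancel_left] using h1

/-- **THE CRITERION: for `θ ∈ Alg(Dm M)`, `θ ∧ w K N m q = 0 ↔ ∀ j ≤ m − M, θ ∧ w K N M (σ^j q) = 0`** (`M ≤ m ≤ N`). -/
theorem mul_w_eq_zero_iff_forall_shift {M m : ℕ} (hMm : M ≤ m) (hm : m ≤ N) (q : ℕ → K) {θ : HT K (In N)} (hθ : θ ∈ Alg K (In N) (Dm N M)) :
    θ * w K N m q = 0 ↔ ∀ j ≤ m - M, θ * w K N M ((shift K)^[j] q) = 0 :=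
  ⟨mul_w_shift_eq_zero_of_mul_w_eq_zero K hMm hm q hθ, mul_w_eq_zero_of_forall_shift K hMm q⟩

/-- **KERNEL FORM: for a `k`-form `θ ∈ Hom(Dm M, k)` of the first `M` pairs, `θ ∈ Kr K (Dm M) (w_N q) k ↔ ∀ j ≤ N − M, θ ∈ Kr K (Dm M) (w_M(σ^j q)) k`.** -/
theorem mem_Kr_w_iff_forall_shift {M : ℕ} (hM : M ≤ N) (k : ℕ) (q : ℕ → K) {θ : HT K (In N)} (hθ : θ ∈ Hom K (In N) (Dm N M) k) :
    θ ∈ Kr K (Dm N M) (w K N N q) k ↔ ∀ j ≤ N - M, θ ∈ Kr K (Dm N M) (w K N M ((shift K)^[j] q)) k := by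
  constructor
  · intro h j hj
    exact mem_Kr.mpr ⟨hθ, mul_w_shift_eq_zero_of_mul_w_eq_zero K hM le_rfl q (Hom_le_Alg K _ _ hθ) (mem_Kr.mp h).2 j hj⟩
  · exact mem_Kr_w_of_forall_mem_Kr_w_shift K hM _ k q hθ

/-- **SUBMODULE FORM: `Kr K (Dm M) (w_N q) k = Hom(Dm M, k) ⊓ ⨅_{j : Fin (N − M + 1)} Kr K (Dm M) (w_M(σ^j q)) k`** — the kernel of the class of the box on the `k`-forms of the
first `M` pairs is the intersection of the kernels of the `N − M + 1` shifted classes of that sub-box (`M ≤ N`, every field, every `q`). -/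
theorem Kr_w_eq_iInf_Kr_w_shift {M : ℕ} (hM : M ≤ N) (k : ℕ) (q : ℕ → K) :
    Kr K (Dm N M) (w K N N q) k = Hom K (In N) (Dm N M) k ⊓ ⨅ j : Fin (N - M + 1), Kr K (Dm N M) (w K N M ((shift K)^[(j : ℕ)] q)) k := by
  refine le_antisymm (fun θ hθ => ?_) (iInf_Kr_w_shift_le_Kr_w K hM _ k q)
  have hθ1 : θ ∈ Hom K (In N) (Dm N M) k := (mem_Kr.mp hθ).1
  refine Submodule.mem_inf.mpr ⟨hθ1, (Submodule.mem_iInf _).mpr fun j => ?_⟩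
  have hj := j.isLt
  exact (mem_Kr_w_iff_forall_shift K hM k q hθ1).mp hθ j (by omega)

end Summit.Ventures.HSemireg.Wedge.HankelOuter
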